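import Literature.NumberTheory.LFunctions.SuzukiSingleOperatorKernel
import Literature.NumberTheory.LFunctions.RiemannXiLogDeriv
import Literature.Analysis.SpecialFunctions.DigammaVerticalSeries
import HarnessLib

/-!
# Suzuki's single-operator kernel `K_θ`: proofs of [Su20] Thm. 1.2 (K-iii) and of the Fourier formula of (K-ii)

Companion ("de-factification") file of `SuzukiSingleOperatorKernel.lean`, which states M. Suzuki,
*Integral operators arising from the Riemann zeta function*, Adv. Stud. Pure Math. **84** (2020) 399–411
= arXiv:1907.07302 [Suzuki2020IntegralOperators], Thm. 1.2, as the named fact `Suzuki2020_thm12` about the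
spectrally defined kernel `limKernel θ x = Re (2π)⁻¹ ∫_{Im z = 1} Θ_θ(z) e^{−izx} dz`,
`Θ_θ(z) = limTheta θ z = exp(−2θ (ξ'/ξ)(½ − iz))`.

PROVED HERE, for every `θ > 1` (the printed range), RH-free throughout:

* §1 a uniform Stirling-type LOWER bound `Re ψ(w) ≥ log ‖w‖ − 3` on `Re w ≥ ½` (near the real axis from
  `Re ψ(a+ib) ≥ ψ(a)` — termwise in Gauss' series — and `Literature.Analysis.SpecialFunctions.Real.log_sub_le_re_digamma`;
  away from it from `Literature.Analysis.SpecialFunctions.Complex.log_norm_sub_le_re_digamma`);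
* §2 `Re ξ'/ξ(s) ≥ ½ log ‖s/2‖ − A(σ₀)` on `Re s ≥ σ₀ > 1` (explicit formula
  `logDeriv_riemannXi_eq_of_one_lt_re` + §1 + `|Σ Λ(n)n^{-s}| ≤ Σ Λ(n)n^{-σ₀}`), whence the symbol decay
  `‖Θ_θ(u + ib)‖ ≤ C (1 + |u|)^{−θ}` UNIFORMLY in `b ≥ b₀ > ½`;
* §3 a generic horizontal line-shift lemma (Cauchy–Goursat on `[−R,R] × [a,b]`, vanishing vertical sides) and
  the independence of `invFourierLine (limTheta θ) b x` of the line `b > ½`;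
* §4 **(K-iii)** `limKernel θ x = 0` for `x < 0` (`b → ∞`);
* §5 reality of the line integral (`ξ(s̄) = conj ξ(s)`), continuity of `K_θ` ((K-ii), first clause) and the
  growth bounds `|K_θ(x)| ≤ C_b e^{bx}` for every `b > ½`;
* §6 **the Fourier formula of (K-ii)**: for `Im z > ½`, `x ↦ K_θ(x)e^{izx}` is integrable on `ℝ` and
  `∫ K_θ(x) e^{izx} dx = Θ_θ(z)` (Mathlib's Fourier inversion `Continuous.fourierInv_fourier_eq`, rescaled
  by `2π`), together with the `(0,∞)` form used by the DBR column.

NOT proved here (they stay inside the named fact `Suzuki2020_thm12`): the sharp growth `K_θ(x) ≪ e^{x/2}`,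
(K-iv) (differentiability off `{log n}`), (K-v) (Fredholm windows), and the series representation (1.12).

## References

* [Suzuki2020IntegralOperators] M. Suzuki, ASPM 84 (2020) 399–411 = arXiv:1907.07302, Thm. 1.2 (K-ii), (K-iii).
* [Titchmarsh1986] E. C. Titchmarsh, *The Theory of the Riemann Zeta-Function*, 2nd ed., §2.12 (`ζ ≠ 0` on `Re s ≥ 1`).
-/

noncomputable section

open Complex MeasureTheory Filter Topology Set
open scoped Real ComplexConjugate FourierTransform

namespace Literature.NumberTheory.LFunctions

open Literature.Analysis.SpecialFunctions Literature.Analysis.SpecialFunctions.Complex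

/-! ## §1 A uniform lower bound for `Re ψ` on `Re w ≥ ½` -/

/-- `Re ψ(a + ib) ≥ ψ(a)` for `a > 0`: termwise in Gauss' series `ψ(w) + γ = Σ (1/(k+1) − 1/(w+k))`,
since `Re (1/(w+k)) = (a+k)/((a+k)²+b²) ≤ 1/(a+k)`. [cite: AndrewsAskeyRoy1999, Thm. 1.2.5 eq. (1.2.13)] -/
theorem re_digamma_ofReal_le_re_digamma {w : ℂ} (hw : 0 < w.re) :
    (digamma (w.re : ℂ)).re ≤ (digamma w).re := by
  have hw' : 0 < ((w.re : ℂ)).re := by simpa using hw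
  have h1 := (hasSum_one_div_sub_one_div_digamma hw).mapL Complex.reCLM
  have h2 := (hasSum_one_div_sub_one_div_digamma hw').mapL Complex.reCLM
  simp only [Complex.reCLM_apply, Complex.add_re, Complex.ofReal_re] at h1 h2
  have hle : ∀ k : ℕ, (1 / ((k : ℂ) + 1) - 1 / ((w.re : ℂ) + k)).re ≤
      (1 / ((k : ℂ) + 1) - 1 / (w + k)).re := by
    intro k
    have hak : 0 < w.re + k := by positivity
    have eA : (1 / ((w.re : ℂ) + k)).re = 1 / (w.re + k) := by
      have : (1 / ((w.re : ℂ) + k)) = ((1 / (w.re + k) : ℝ) : ℂ) := by push_cast; ring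
      rw [this, Complex.ofReal_re]
    have eB : (1 / (w + k)).re = (w.re + k) / ((w.re + k) ^ 2 + w.im ^ 2) := by
      have := re_one_div_add_ofReal w (k : ℝ)
      simpa using this
    rw [Complex.sub_re, Complex.sub_re, eA, eB]
    have e2 : (w.re + k) / ((w.re + k) ^ 2 + w.im ^ 2) ≤ 1 / (w.re + k) := by
      rw [div_le_div_iff₀ (by positivity) hak]
      nlinarith [sq_nonneg w.im]
    linarith
  have := hasSum_le hle h2 h1
  linarith

/-- **Uniform Stirling-type lower bound**: `log ‖w‖ − 3 ≤ Re ψ(w)` for `Re w ≥ ½`. Near the real axis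
(`|Im w| ≤ Re w`): `Re ψ(w) ≥ ψ(Re w) ≥ log(Re w) − 1/(2 Re w) − 1/(12 (Re w)²)` and `‖w‖ ≤ 2·Re w`; away from
it (`|Im w| > Re w`): `Re ψ(w) ≥ log ‖w‖ − 1/(2‖w‖²) − π/(4|Im w|)` with `|Im w| > ½`, `‖w‖² > ½`. A weak explicit
form of Stirling's formula `ψ(s) = log s − 1/(2s) − … ` in `|arg s| ≤ π − δ`, the input of Suzuki's §3.
[cite: Suzuki2020IntegralOperators, §3, proof of Prop. 3.1 (Stirling's formula for ψ, after [WW])] -/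
theorem log_norm_sub_three_le_re_digamma {w : ℂ} (hw : 1 / 2 ≤ w.re) :
    Real.log ‖w‖ - 3 ≤ (digamma w).re := by
  have hw0 : 0 < w.re := by linarith
  have habs : |w.im| ≤ ‖w‖ := Complex.abs_im_le_norm w
  have hre : w.re ≤ ‖w‖ := Complex.re_le_norm w
  have hnorm_pos : 0 < ‖w‖ := lt_of_lt_of_le hw0 hre
  rcases le_or_gt |w.im| w.re with him | him
  · -- near the real axis
    have h1 := re_digamma_ofReal_le_re_digamma hw0
    have h2 := Real.log_sub_le_re_digamma hw0
    have hn : ‖w‖ ≤ 2 * w.re := by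
      have h := Complex.norm_le_abs_re_add_abs_im w
      rw [abs_of_pos hw0] at h
      linarith
    have hlog : Real.log ‖w‖ ≤ Real.log 2 + Real.log w.re := by
      rw [← Real.log_mul (by norm_num) hw0.ne']
      exact Real.log_le_log hnorm_pos hn
    have hlog2 : Real.log 2 < 1 := by
      have := Real.log_two_lt_d9; linarith
    have h3 : 1 / (2 * w.re) ≤ 1 := by
      rw [div_le_one (by positivity)]; linarith
    have h4 : 1 / (12 * w.re ^ 2) ≤ 1 / 3 := by
      rw [div_le_div_iff₀ (by positivity) (by norm_num)]
      nlinarith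
    linarith
  · -- away from the real axis
    have him0 : w.im ≠ 0 := by
      intro h; rw [h, abs_zero] at him; linarith
    have h1 := log_norm_sub_le_re_digamma hw0 him0
    have h2 : Real.pi / (4 * |w.im|) ≤ Real.pi / 2 := by
      rw [div_le_div_iff₀ (by positivity) (by norm_num)]
      nlinarith [Real.pi_pos]
    have h3 : 1 / (2 * ‖w‖ ^ 2) ≤ 1 := by
      rw [div_le_one (by positivity)]
      have hsq : ‖w‖ ^ 2 = w.re ^ 2 + w.im ^ 2 := by
        rw [Complex.sq_norm, Complex.normSq_apply]; ring
      have him2 : w.re ^ 2 < w.im ^ 2 := by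
        have h := mul_self_lt_mul_self hw0.le him
        rw [← sq, ← sq, sq_abs] at h
        exact h
      nlinarith
    linarith [Real.pi_lt_four]

/-! ## §2 `Re ξ'/ξ` from below on `Re s ≥ σ₀ > 1`; decay of `Θ_θ` on the lines `Im z = b ≥ b₀ > ½` -/

open LSeries in
open scoped LSeries.notation ArithmeticFunction.vonMangoldt in
/-- `|Σ Λ(n) n^{-s}| ≤ Σ Λ(n) n^{-σ₀}` for `Re s ≥ σ₀ > 1` (termwise). [folklore] -/
private theorem norm_LSeries_vonMangoldt_le_tsum {σ₀ : ℝ} (hσ₀ : 1 < σ₀) {s : ℂ} (hs : σ₀ ≤ s.re) :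
    ‖L ↗Λ s‖ ≤ ∑' n : ℕ, ‖term ↗Λ (σ₀ : ℂ) n‖ := by
  have hsum0 : Summable fun n ↦ ‖term ↗Λ (σ₀ : ℂ) n‖ := by
    have h := ArithmeticFunction.LSeriesSummable_vonMangoldt (s := (σ₀ : ℂ)) (by simpa using hσ₀)
    exact summable_norm_iff.mpr h
  have hle : ∀ n, ‖term ↗Λ s n‖ ≤ ‖term ↗Λ (σ₀ : ℂ) n‖ := fun n ↦
    norm_term_le_of_re_le_re _ (by simpa using hs) n
  have hsum : Summable fun n ↦ ‖term ↗Λ s n‖ :=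
    Summable.of_nonneg_of_le (fun _ ↦ norm_nonneg _) hle hsum0
  calc ‖L ↗Λ s‖ = ‖∑' n, term ↗Λ s n‖ := rfl
    _ ≤ ∑' n, ‖term ↗Λ s n‖ := norm_tsum_le_tsum_norm hsum
    _ ≤ ∑' n, ‖term ↗Λ (σ₀ : ℂ) n‖ := hsum.tsum_le_tsum hle hsum0

open LSeries in
open scoped LSeries.notation ArithmeticFunction.vonMangoldt in
/-- **`Re ξ'/ξ` from below on `Re s ≥ σ₀ > 1`:**
`½ log ‖s/2‖ − (5/2 + Σ Λ(n)n^{-σ₀}) ≤ Re ξ'/ξ(s)`, from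
`ξ'/ξ = 1/s + 1/(s−1) − (log π)/2 + ½ψ(s/2) − Σ Λ(n) n^{-s}` (`Re 1/s, Re 1/(s−1) ≥ 0`, `log π < 2`,
§1 for `ψ(s/2)`) — Suzuki's «growth of ψ(s) and the non-vanishing of ζ(s) for Re(s) ≥ 1» made explicit on
`Re s ≥ σ₀ > 1`. [cite: Suzuki2020IntegralOperators, §3, proof of Thm. 1.2 (K-ii)] -/
theorem re_logDeriv_riemannXi_ge {σ₀ : ℝ} (hσ₀ : 1 < σ₀) {s : ℂ} (hs : σ₀ ≤ s.re) :
    Real.log ‖s / 2‖ / 2 - (5 / 2 + ∑' n : ℕ, ‖term ↗Λ (σ₀ : ℂ) n‖) ≤ (logDeriv riemannXi s).re := by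
  have hs1 : 1 < s.re := by linarith
  rw [logDeriv_riemannXi_eq_of_one_lt_re hs1]
  simp only [Complex.add_re, Complex.sub_re]
  have h1 : 0 ≤ (1 / s).re := by
    rw [one_div, Complex.inv_re]; exact div_nonneg (by linarith) (Complex.normSq_nonneg _)
  have h2 : 0 ≤ (1 / (s - 1)).re := by
    rw [one_div, Complex.inv_re]
    exact div_nonneg (by simp; linarith) (Complex.normSq_nonneg _)
  have h3 : (-(Real.log π : ℂ) / 2).re = -(Real.log π) / 2 := by
    have : (-(Real.log π : ℂ) / 2) = ((-(Real.log π) / 2 : ℝ) : ℂ) := by push_cast; ring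
    rw [this, Complex.ofReal_re]
  have h4 : ((1 / 2 : ℂ) * digamma (s / 2)).re = (digamma (s / 2)).re / 2 := by
    have : ((1 / 2 : ℂ) * digamma (s / 2)).re = 1 / 2 * (digamma (s / 2)).re := by
      rw [show (1 / 2 : ℂ) = ((1 / 2 : ℝ) : ℂ) by push_cast; ring, Complex.re_ofReal_mul]
    rw [this]; ring
  have h5 : Real.log ‖s / 2‖ - 3 ≤ (digamma (s / 2)).re :=
    log_norm_sub_three_le_re_digamma (by simp; linarith)
  have h6 : (L ↗Λ s).re ≤ ∑' n : ℕ, ‖term ↗Λ (σ₀ : ℂ) n‖ :=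
    (Complex.re_le_norm _).trans (norm_LSeries_vonMangoldt_le_tsum hσ₀ hs)
  have h7 := log_pi_lt_two
  have h8 : 0 < Real.log π := Real.log_pos (by linarith [Real.pi_gt_three])
  rw [h3, h4]
  linarith

/-- `‖Θ_θ(z)‖ = exp(−2θ · Re ξ'/ξ(½ − iz))`. [cite: Suzuki2020IntegralOperators, §1 eq. (1.9)] -/
theorem norm_limTheta (θ : ℝ) (z : ℂ) :
    ‖limTheta θ z‖ = Real.exp (-2 * θ * (logDeriv riemannXi (1 / 2 - I * z)).re) := by
  unfold limTheta
  rw [Complex.norm_exp, logDeriv_apply]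
  congr 1
  have h : (-2 * (θ : ℂ) * (deriv riemannXi (1 / 2 - I * z) / riemannXi (1 / 2 - I * z))) =
      (((-2 * θ : ℝ)) : ℂ) * (deriv riemannXi (1 / 2 - I * z) / riemannXi (1 / 2 - I * z)) := by
    push_cast; ring
  rw [h, Complex.re_ofReal_mul]

/-- `½ − i(u + ib) = (½ + b) − iu`: real part `½ + b`, imaginary part `−u`. [folklore] -/
private theorem half_sub_I_mul_line_eq (u b : ℝ) :
    (1 : ℂ) / 2 - I * ((u : ℂ) + (b : ℂ) * I) = (((1 / 2 + b : ℝ)) : ℂ) + ((-u : ℝ) : ℂ) * I := by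
  push_cast
  linear_combination (-(b : ℂ)) * I_mul_I

/-- `Re(½ − i(u + ib)) = ½ + b`. [folklore] -/
private theorem re_half_sub_I_mul_line (u b : ℝ) : ((1 : ℂ) / 2 - I * ((u : ℂ) + (b : ℂ) * I)).re = 1 / 2 + b := by
  rw [half_sub_I_mul_line_eq]; simp

/-- `Im(½ − i(u + ib)) = −u`. [folklore] -/
private theorem im_half_sub_I_mul_line (u b : ℝ) : ((1 : ℂ) / 2 - I * ((u : ℂ) + (b : ℂ) * I)).im = -u := by
  rw [half_sub_I_mul_line_eq]; simp

/-- `‖(½ + b) − iu‖ ≥ (1 + |u|)/2` when `½ + b ≥ 1`. [folklore] -/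
private theorem norm_half_sub_I_mul_line_ge {u b : ℝ} (hb : 1 / 2 ≤ b) :
    (1 + |u|) / 2 ≤ ‖(1 : ℂ) / 2 - I * ((u : ℂ) + (b : ℂ) * I)‖ := by
  set s := (1 : ℂ) / 2 - I * ((u : ℂ) + (b : ℂ) * I) with hs
  have hre : 1 ≤ s.re := by rw [hs, re_half_sub_I_mul_line]; linarith
  have him : |u| = |s.im| := by rw [hs, im_half_sub_I_mul_line, abs_neg]
  have h1 : s.re ≤ ‖s‖ := Complex.re_le_norm s
  have h2 : |s.im| ≤ ‖s‖ := Complex.abs_im_le_norm s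
  rw [him]
  rcases le_or_gt |s.im| 1 with h | h
  · linarith
  · linarith

open LSeries in
open scoped LSeries.notation ArithmeticFunction.vonMangoldt in
/-- **Uniform symbol decay** (RH-free): for `θ ≥ 0` and `b₀ > ½` there is `C` with
`‖Θ_θ(u + ib)‖ ≤ C (1 + |u|)^{−θ}` for all `b ≥ b₀` and all real `u` (§2 bound for `Re ξ'/ξ` on
`Re s ≥ ½ + b₀ > 1`, and `‖s/2‖ ≥ (1+|u|)/4`). This is the decay `|u|^{−θ}` behind the absolute convergence
of (1.9) for `θ > 1`. [cite: Suzuki2020IntegralOperators, Thm. 1.2 (K-ii)] -/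
theorem norm_limTheta_line_le {θ b₀ : ℝ} (hθ : 0 ≤ θ) (hb₀ : 1 / 2 < b₀) :
    ∃ C : ℝ, 0 < C ∧ ∀ b : ℝ, b₀ ≤ b → ∀ u : ℝ,
      ‖limTheta θ ((u : ℂ) + (b : ℂ) * I)‖ ≤ C * (1 + |u|) ^ (-θ) := by
  set σ₀ : ℝ := 1 / 2 + b₀ with hσ₀def
  have hσ₀ : 1 < σ₀ := by rw [hσ₀def]; linarith
  set A : ℝ := 5 / 2 + ∑' n : ℕ, ‖term ↗Λ (σ₀ : ℂ) n‖ with hA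
  refine ⟨Real.exp (2 * θ * A) * 4 ^ θ, by positivity, fun b hb u => ?_⟩
  set s := (1 : ℂ) / 2 - I * ((u : ℂ) + (b : ℂ) * I) with hs
  have hsre : σ₀ ≤ s.re := by rw [hs, re_half_sub_I_mul_line, hσ₀def]; linarith
  have hlow := re_logDeriv_riemannXi_ge hσ₀ hsre
  have hnorm : (1 + |u|) / 4 ≤ ‖s / 2‖ := by
    rw [norm_div, Complex.norm_two]
    have := norm_half_sub_I_mul_line_ge (u := u) (b := b) (by linarith)
    rw [← hs] at this
    linarith
  have hpos : 0 < (1 + |u|) / 4 := by positivity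
  have hpos' : 0 < ‖s / 2‖ := lt_of_lt_of_le hpos hnorm
  rw [norm_limTheta, ← hs]
  -- `exp(-2θ R) ≤ exp(2θA) · ‖s/2‖^{-θ} ≤ exp(2θA) · ((1+|u|)/4)^{-θ} = exp(2θA) 4^θ (1+|u|)^{-θ}`
  have step1 : -2 * θ * (logDeriv riemannXi s).re ≤ 2 * θ * A + (-θ) * Real.log ‖s / 2‖ := by
    have := mul_le_mul_of_nonneg_left hlow (by linarith : 0 ≤ 2 * θ)
    nlinarith
  calc Real.exp (-2 * θ * (logDeriv riemannXi s).re)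
      ≤ Real.exp (2 * θ * A + (-θ) * Real.log ‖s / 2‖) := Real.exp_le_exp.2 step1
    _ = Real.exp (2 * θ * A) * ‖s / 2‖ ^ (-θ) := by
        rw [Real.exp_add, Real.rpow_def_of_pos hpos', mul_comm (Real.log _)]
    _ ≤ Real.exp (2 * θ * A) * ((1 + |u|) / 4) ^ (-θ) :=
        mul_le_mul_of_nonneg_left (Real.rpow_le_rpow_of_nonpos hpos hnorm (by linarith))
          (by positivity)
    _ = Real.exp (2 * θ * A) * 4 ^ θ * (1 + |u|) ^ (-θ) := by
        rw [Real.div_rpow (by positivity) (by norm_num), Real.rpow_neg (by norm_num : (0:ℝ) ≤ 4),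
          inv_eq_one_div]
        field_simp

/-! ## §3 Regularity of `Θ_θ`, a generic horizontal line shift, and line independence of `invFourierLine Θ_θ b` -/

/-- `ξ'` is entire (as `ξ` is). [cite: Titchmarsh1986, §2.1] -/
theorem differentiable_deriv_riemannXi : Differentiable ℂ (deriv riemannXi) := fun z =>
  ((differentiable_riemannXi).analyticAt z).deriv.differentiableAt

/-- `Θ_θ` is complex differentiable at every `z` with `Im z ≥ ½` (`ξ(½ − iz) ≠ 0` there since
`Re(½ − iz) = ½ + Im z ≥ 1`). [cite: Suzuki2020IntegralOperators, §1 eq. (1.9)] -/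
theorem differentiableAt_limTheta (θ : ℝ) {z : ℂ} (hz : 1 / 2 ≤ z.im) :
    DifferentiableAt ℂ (limTheta θ) z := by
  have hs : riemannXi (1 / 2 - I * z) ≠ 0 := riemannXi_ne_zero_of_one_le_re (by simp; linarith)
  have haff : DifferentiableAt ℂ (fun w : ℂ => (1 : ℂ) / 2 - I * w) z := by fun_prop
  unfold limTheta
  refine ((((differentiable_deriv_riemannXi _).comp z haff).div
    ((differentiable_riemannXi _).comp z haff) hs).const_mul _).cexp

/-- `Θ_θ` is holomorphic on the closed half-plane `Im z ≥ ½`. [cite: Suzuki2020IntegralOperators, §1 eq. (1.9)] -/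
theorem differentiableOn_limTheta (θ : ℝ) : DifferentiableOn ℂ (limTheta θ) {z : ℂ | 1 / 2 ≤ z.im} :=
  fun _ hz => (differentiableAt_limTheta θ hz).differentiableWithinAt

/-- `u ↦ Θ_θ(u + ib)` is continuous for `b ≥ ½`. [cite: Suzuki2020IntegralOperators, §1 eq. (1.9)] -/
theorem continuous_limTheta_line (θ : ℝ) {b : ℝ} (hb : 1 / 2 ≤ b) :
    Continuous fun u : ℝ => limTheta θ ((u : ℂ) + (b : ℂ) * I) := by
  exact (differentiableOn_limTheta θ).continuousOn.comp_continuous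
    (by fun_prop : Continuous fun u : ℝ => (u : ℂ) + (b : ℂ) * I) fun u => by simpa using hb

/-- `Re(−i(u + ib)x) = bx` and `‖e^{−i(u+ib)x}‖ = e^{bx}`. [folklore] -/
private theorem norm_cexp_neg_I_line (b x u : ℝ) :
    ‖Complex.exp (-I * ((u : ℂ) + (b : ℂ) * I) * (x : ℂ))‖ = Real.exp (b * x) := by
  rw [Complex.norm_exp]
  congr 1
  simp only [Complex.mul_re, Complex.mul_im, Complex.neg_re, Complex.neg_im, Complex.add_re,
    Complex.add_im, Complex.I_re, Complex.I_im, Complex.ofReal_re, Complex.ofReal_im]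
  ring

/-- The majorant `(1 + |u|)^{−θ}` is integrable on `ℝ` for `θ > 1`. [folklore] -/
private theorem integrable_one_add_abs_rpow_neg {θ : ℝ} (hθ : 1 < θ) :
    Integrable fun u : ℝ => (1 + |u|) ^ (-θ) := by
  have h := integrable_one_add_norm (E := ℝ) (μ := volume) (r := θ) (by simpa using hθ)
  simpa [Real.norm_eq_abs] using h

/-- For `θ > 1` and `b > ½`, the symbol is integrable along `Im z = b`. [cite: Suzuki2020IntegralOperators, Thm. 1.2 (K-ii)] -/
theorem integrable_limTheta_line {θ : ℝ} (hθ : 1 < θ) {b : ℝ} (hb : 1 / 2 < b) :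
    Integrable fun u : ℝ => limTheta θ ((u : ℂ) + (b : ℂ) * I) := by
  obtain ⟨C, _, hC⟩ := norm_limTheta_line_le (θ := θ) (by linarith) hb
  refine ((integrable_one_add_abs_rpow_neg hθ).const_mul C).mono'
    (continuous_limTheta_line θ hb.le).aestronglyMeasurable (Eventually.of_forall fun u => ?_)
  exact hC b le_rfl u

/-- The inverse-Fourier integrand `Θ_θ(u+ib) e^{−i(u+ib)x}` is integrable in `u` (`θ > 1`, `b > ½`).
[cite: Suzuki2020IntegralOperators, Thm. 1.2 (K-ii)] -/
theorem integrable_limTheta_lineIntegrand {θ : ℝ} (hθ : 1 < θ) {b : ℝ} (hb : 1 / 2 < b) (x : ℝ) :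
    Integrable fun u : ℝ => limTheta θ ((u : ℂ) + (b : ℂ) * I) *
      Complex.exp (-I * ((u : ℂ) + (b : ℂ) * I) * (x : ℂ)) := by
  have hI := integrable_limTheta_line hθ hb
  refine (hI.norm.mul_const (Real.exp (b * x))).mono' ?_ (Eventually.of_forall fun u => ?_)
  · exact hI.1.mul (by fun_prop : Continuous fun u : ℝ =>
      Complex.exp (-I * ((u : ℂ) + (b : ℂ) * I) * (x : ℂ))).aestronglyMeasurable
  · rw [norm_mul, norm_cexp_neg_I_line]

/-- **Horizontal line shift** (Cauchy–Goursat on `[−R, R] × [a, b]`, `R → ∞`): if `g` is holomorphic on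
the closed strip `a ≤ Im z ≤ b`, integrable on both boundary lines, and bounded on the vertical segments
`{±R} × [a,b]` by `h(R) → 0`, then `∫ g(u + ia) du = ∫ g(u + ib) du` — Suzuki's «move the path of integration
as Im(z) = c → +∞» step, in generic form. [cite: Suzuki2020IntegralOperators, §3, proof of Prop. 3.1] -/
theorem integral_line_eq_of_differentiableOn_strip {g : ℂ → ℂ} {a b : ℝ} (hab : a ≤ b)
    (hd : DifferentiableOn ℂ g {z : ℂ | a ≤ z.im ∧ z.im ≤ b})
    (ha : Integrable fun u : ℝ => g ((u : ℂ) + (a : ℂ) * I))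
    (hb : Integrable fun u : ℝ => g ((u : ℂ) + (b : ℂ) * I))
    {h : ℝ → ℝ} (hv : ∀ R y : ℝ, y ∈ Icc a b → ‖g ((R : ℂ) + (y : ℂ) * I)‖ ≤ h |R|)
    (hh : Tendsto h atTop (𝓝 0)) :
    ∫ u : ℝ, g ((u : ℂ) + (a : ℂ) * I) = ∫ u : ℝ, g ((u : ℂ) + (b : ℂ) * I) := by
  -- Cauchy on the rectangles
  have hrect : ∀ R : ℝ, (∫ x : ℝ in (-R)..R, g (x + a * I)) - (∫ x : ℝ in (-R)..R, g (x + b * I)) +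
      I • (∫ y : ℝ in a..b, g (R + y * I)) - I • (∫ y : ℝ in a..b, g (-R + y * I)) = 0 := by
    intro R
    have H := Complex.integral_boundary_rect_eq_zero_of_differentiableOn g (-R + a * I) (R + b * I)
      (hd.mono fun z hz => by
        obtain ⟨_, hz2⟩ := hz
        simp only [add_im, neg_im, ofReal_im, mul_im, ofReal_re, I_im, I_re, mul_one, mul_zero,
          add_zero, neg_zero, zero_add, uIcc_of_le hab, mem_preimage, mem_Icc] at hz2
        exact hz2)
    simpa using H
  -- the limits of the four sides
  have hbot : Tendsto (fun R : ℝ => ∫ x : ℝ in (-R)..R, g (x + a * I)) atTop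
      (𝓝 (∫ u : ℝ, g ((u : ℂ) + (a : ℂ) * I))) :=
    intervalIntegral_tendsto_integral ha tendsto_neg_atTop_atBot tendsto_id
  have htop : Tendsto (fun R : ℝ => ∫ x : ℝ in (-R)..R, g (x + b * I)) atTop
      (𝓝 (∫ u : ℝ, g ((u : ℂ) + (b : ℂ) * I))) :=
    intervalIntegral_tendsto_integral hb tendsto_neg_atTop_atBot tendsto_id
  have hvert : ∀ ε : ℝ, ε = 1 ∨ ε = -1 →
      Tendsto (fun R : ℝ => ∫ y : ℝ in a..b, g ((ε * R : ℝ) + y * I)) atTop (𝓝 0) := by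
    intro ε hε
    have hεabs : ∀ R : ℝ, |ε * R| = |R| := by
      intro R; rcases hε with h1 | h1 <;> simp [h1, abs_neg]
    rw [tendsto_zero_iff_norm_tendsto_zero]
    have hbound : ∀ R : ℝ, ‖∫ y : ℝ in a..b, g ((ε * R : ℝ) + y * I)‖ ≤ h |R| * |b - a| := by
      intro R
      refine intervalIntegral.norm_integral_le_of_norm_le_const fun y hy => ?_
      rw [uIoc_of_le hab] at hy
      have := hv (ε * R) y ⟨hy.1.le, hy.2⟩
      rwa [hεabs] at this
    have hlim : Tendsto (fun R : ℝ => h |R| * |b - a|) atTop (𝓝 0) := by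
      have := (hh.comp tendsto_abs_atTop_atTop).mul_const |b - a|
      simpa using this
    exact squeeze_zero (fun R => norm_nonneg _) hbound hlim
  have hright := hvert 1 (Or.inl rfl)
  have hleft := hvert (-1) (Or.inr rfl)
  simp only [one_mul, neg_mul] at hright hleft
  have hlim : Tendsto (fun R : ℝ => (∫ x : ℝ in (-R)..R, g (x + a * I)) -
      (∫ x : ℝ in (-R)..R, g (x + b * I)) +
      I • (∫ y : ℝ in a..b, g (R + y * I)) - I • (∫ y : ℝ in a..b, g (-R + y * I))) atTop
      (𝓝 ((∫ u : ℝ, g ((u : ℂ) + (a : ℂ) * I)) - (∫ u : ℝ, g ((u : ℂ) + (b : ℂ) * I)) +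
        I • (0 : ℂ) - I • (0 : ℂ))) := by
    have hr' : Tendsto (fun R : ℝ => ∫ y : ℝ in a..b, g (R + y * I)) atTop (𝓝 0) :=
      hright.congr fun R => by simp
    have hl' : Tendsto (fun R : ℝ => ∫ y : ℝ in a..b, g (-R + y * I)) atTop (𝓝 0) :=
      hleft.congr fun R => by simp
    exact ((hbot.sub htop).add (hr'.const_smul I)).sub (hl'.const_smul I)
  have h0 := tendsto_nhds_unique hlim (by simp_rw [hrect]; exact tendsto_const_nhds)
  simp only [smul_zero, add_zero, sub_zero] at h0
  exact sub_eq_zero.1 h0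

/-- **Line independence** (RH-free): for `θ > 1` the inverse Fourier transform of `Θ_θ` along `Im z = b`
does not depend on `b > ½` (Cauchy's theorem; the vertical sides vanish by the uniform decay of §2).
[cite: Suzuki2020IntegralOperators, Thm. 1.2 (K-ii)] -/
theorem invFourierLine_limTheta_eq {θ : ℝ} (hθ : 1 < θ) {b₁ b₂ : ℝ} (hb₁ : 1 / 2 < b₁) (hb₂ : 1 / 2 < b₂)
    (x : ℝ) : invFourierLine (limTheta θ) b₁ x = invFourierLine (limTheta θ) b₂ x := by
  -- reduce to `b₁ ≤ b₂`
  wlog hle : b₁ ≤ b₂ generalizing b₁ b₂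
  · exact (this hb₂ hb₁ (le_of_not_ge hle)).symm
  unfold invFourierLine
  congr 1
  set b₀ := min b₁ b₂ with hb₀def
  have hb₀ : 1 / 2 < b₀ := lt_min hb₁ hb₂
  obtain ⟨C, hC0, hC⟩ := norm_limTheta_line_le (θ := θ) (by linarith) hb₀
  set g : ℂ → ℂ := fun z => limTheta θ z * Complex.exp (-I * z * (x : ℂ)) with hg
  have hga : (fun u : ℝ => g ((u : ℂ) + (b₁ : ℂ) * I)) = fun u : ℝ => limTheta θ ((u : ℂ) + (b₁ : ℂ) * I) *
      Complex.exp (-I * ((u : ℂ) + (b₁ : ℂ) * I) * (x : ℂ)) := rfl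
  have hgb : (fun u : ℝ => g ((u : ℂ) + (b₂ : ℂ) * I)) = fun u : ℝ => limTheta θ ((u : ℂ) + (b₂ : ℂ) * I) *
      Complex.exp (-I * ((u : ℂ) + (b₂ : ℂ) * I) * (x : ℂ)) := rfl
  have key := integral_line_eq_of_differentiableOn_strip (g := g) hle ?_ ?_ ?_
    (h := fun R => C * (1 + R) ^ (-θ) * Real.exp (max (b₁ * x) (b₂ * x))) ?_ ?_
  · simpa [hg] using key
  · -- holomorphy on the strip
    intro z hz
    have hz' : 1 / 2 ≤ z.im := by linarith [hz.1]
    exact ((differentiableAt_limTheta θ hz').mul (by fun_prop)).differentiableWithinAt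
  · rw [hga]; exact integrable_limTheta_lineIntegrand hθ hb₁ x
  · rw [hgb]; exact integrable_limTheta_lineIntegrand hθ hb₂ x
  · -- vertical sides
    intro R y hy
    have hyb : b₀ ≤ y := le_trans (min_le_left _ _) hy.1
    have h1 := hC y hyb R
    have h2 : ‖Complex.exp (-I * ((R : ℂ) + (y : ℂ) * I) * (x : ℂ))‖ ≤ Real.exp (max (b₁ * x) (b₂ * x)) := by
      rw [norm_cexp_neg_I_line, Real.exp_le_exp]
      -- `y x` lies between `b₁ x` and `b₂ x`
      rcases le_or_gt 0 x with hx | hx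
      · exact le_trans (mul_le_mul_of_nonneg_right hy.2 hx) (le_max_right _ _)
      · exact le_trans (mul_le_mul_of_nonpos_right hy.1 hx.le) (le_max_left _ _)
    have hR : (1 + |R|) ^ (-θ) = (1 + |(|R|)|) ^ (-θ) := by rw [abs_abs]
    calc ‖g ((R : ℂ) + (y : ℂ) * I)‖
        = ‖limTheta θ ((R : ℂ) + (y : ℂ) * I)‖ * ‖Complex.exp (-I * ((R : ℂ) + (y : ℂ) * I) * (x : ℂ))‖ := by
          rw [hg]; exact norm_mul _ _
      _ ≤ C * (1 + |R|) ^ (-θ) * Real.exp (max (b₁ * x) (b₂ * x)) :=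
          mul_le_mul h1 h2 (norm_nonneg _) (by positivity)
      _ = C * (1 + |R|) ^ (-θ) * Real.exp (max (b₁ * x) (b₂ * x)) := rfl
  · -- the majorant tends to `0`
    have h1 : Tendsto (fun R : ℝ => (1 + R) ^ (-θ)) atTop (𝓝 0) := by
      have := (tendsto_rpow_neg_atTop (by linarith : 0 < θ)).comp
        (tendsto_atTop_add_const_left atTop 1 tendsto_id)
      exact this
    have := (h1.const_mul C).mul_const (Real.exp (max (b₁ * x) (b₂ * x)))
    simpa using this

/-! ## §4 (K-iii): `K_θ = 0` on `(−∞, 0)` -/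

/-- `‖(1/2π) ∫ Φ(u+ic) e^{−i(u+ic)x} du‖ ≤ (1/2π) e^{cx} ∫ ‖Φ(u+ic)‖ du` (junk-compatible: both sides make
sense unconditionally); the object is the line integral (1.9)/(2.6). [cite: Suzuki2020IntegralOperators, §1 eq. (1.9)] -/
theorem norm_invFourierLine_le (Φ : ℂ → ℂ) (c x : ℝ) :
    ‖invFourierLine Φ c x‖ ≤
      1 / (2 * Real.pi) * Real.exp (c * x) * ∫ u : ℝ, ‖Φ ((u : ℂ) + (c : ℂ) * I)‖ := by
  unfold invFourierLine
  have hn : ‖(1 : ℂ) / (2 * (Real.pi : ℂ))‖ = 1 / (2 * Real.pi) := by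
    rw [norm_div, norm_mul, norm_one, Complex.norm_real, Complex.norm_two, Real.norm_eq_abs,
      abs_of_pos Real.pi_pos]
  rw [norm_mul, hn]
  have h1 : ‖∫ u : ℝ, Φ ((u : ℂ) + (c : ℂ) * I) * Complex.exp (-I * ((u : ℂ) + (c : ℂ) * I) * (x : ℂ))‖
      ≤ ∫ u : ℝ, ‖Φ ((u : ℂ) + (c : ℂ) * I)‖ * Real.exp (c * x) := by
    refine (norm_integral_le_integral_norm _).trans (le_of_eq ?_)
    congr 1
    funext u
    rw [norm_mul, norm_cexp_neg_I_line]
  rw [integral_mul_const] at h1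
  calc 1 / (2 * Real.pi) *
        ‖∫ u : ℝ, Φ ((u : ℂ) + (c : ℂ) * I) * Complex.exp (-I * ((u : ℂ) + (c : ℂ) * I) * (x : ℂ))‖
      ≤ 1 / (2 * Real.pi) * ((∫ u : ℝ, ‖Φ ((u : ℂ) + (c : ℂ) * I)‖) * Real.exp (c * x)) :=
        mul_le_mul_of_nonneg_left h1 (by positivity)
    _ = 1 / (2 * Real.pi) * Real.exp (c * x) * ∫ u : ℝ, ‖Φ ((u : ℂ) + (c : ℂ) * I)‖ := by ring

/-- Uniform growth of the line transforms (RH-free): for `θ > 1`, `b₀ > ½` there is `D ≥ 0` with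
`‖invFourierLine Θ_θ b x‖ ≤ D e^{bx}` for all `b ≥ b₀` and all `x`. [cite: Suzuki2020IntegralOperators, Thm. 1.2 (K-ii)] -/
theorem norm_invFourierLine_limTheta_le {θ : ℝ} (hθ : 1 < θ) {b₀ : ℝ} (hb₀ : 1 / 2 < b₀) :
    ∃ D : ℝ, 0 ≤ D ∧ ∀ b : ℝ, b₀ ≤ b → ∀ x : ℝ,
      ‖invFourierLine (limTheta θ) b x‖ ≤ D * Real.exp (b * x) := by
  obtain ⟨C, hC0, hC⟩ := norm_limTheta_line_le (θ := θ) (by linarith) hb₀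
  set M : ℝ := ∫ u : ℝ, (1 + |u|) ^ (-θ) with hM
  refine ⟨1 / (2 * Real.pi) * (C * M), by positivity, fun b hb x => ?_⟩
  have hint : ∫ u : ℝ, ‖limTheta θ ((u : ℂ) + (b : ℂ) * I)‖ ≤ C * M := by
    rw [hM, ← integral_const_mul]
    refine integral_mono_of_nonneg (Eventually.of_forall fun u => norm_nonneg _)
      ((integrable_one_add_abs_rpow_neg hθ).const_mul C) (Eventually.of_forall fun u => hC b hb u)
  calc ‖invFourierLine (limTheta θ) b x‖
      ≤ 1 / (2 * Real.pi) * Real.exp (b * x) * ∫ u : ℝ, ‖limTheta θ ((u : ℂ) + (b : ℂ) * I)‖ :=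
        norm_invFourierLine_le _ _ _
    _ ≤ 1 / (2 * Real.pi) * Real.exp (b * x) * (C * M) := by gcongr
    _ = 1 / (2 * Real.pi) * (C * M) * Real.exp (b * x) := by ring

/-- **Paley–Wiener vanishing** (RH-free): for `θ > 1`, `b > ½` and `x < 0`, `invFourierLine Θ_θ b x = 0`
(move the line to `Im z = b' → ∞`: the value does not change, and is `O(e^{b'x}) → 0`).
[cite: Suzuki2020IntegralOperators, Thm. 1.2 (K-iii)] -/
theorem invFourierLine_limTheta_eq_zero_of_neg {θ : ℝ} (hθ : 1 < θ) {b : ℝ} (hb : 1 / 2 < b) {x : ℝ}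
    (hx : x < 0) : invFourierLine (limTheta θ) b x = 0 := by
  obtain ⟨D, hD0, hD⟩ := norm_invFourierLine_limTheta_le hθ hb
  set V := invFourierLine (limTheta θ) b x with hV
  have hbound : ∀ b' : ℝ, b ≤ b' → ‖V‖ ≤ D * Real.exp (b' * x) := by
    intro b' hb'
    rw [hV, invFourierLine_limTheta_eq (b₂ := b') hθ hb (by linarith) x]
    exact hD b' hb' x
  have hlim : Tendsto (fun b' : ℝ => D * Real.exp (b' * x)) atTop (𝓝 0) := by
    have h1 : Tendsto (fun b' : ℝ => b' * x) atTop atBot :=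
      tendsto_id.atTop_mul_const_of_neg hx
    have := (Real.tendsto_exp_atBot.comp h1).const_mul D
    simpa using this
  have hle : ‖V‖ ≤ 0 :=
    ge_of_tendsto hlim (Filter.eventually_atTop.2 ⟨b, fun b' hb' => hbound b' hb'⟩)
  exact norm_le_zero_iff.1 hle

/-- **[Su20] Thm. 1.2 (K-iii), PROVED** (RH-free): for `θ > 1`, `K_θ(x) = 0` for `x < 0`.
[cite: Suzuki2020IntegralOperators, Thm. 1.2 (K-iii)] -/
theorem Suzuki2020_thm12_Kiii {θ : ℝ} (hθ : 1 < θ) {x : ℝ} (hx : x < 0) : limKernel θ x = 0 := by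
  show (invFourierLine (limTheta θ) 1 x).re = 0
  rw [invFourierLine_limTheta_eq_zero_of_neg hθ (by norm_num) hx, Complex.zero_re]

/-! ## §5 Reality, continuity and growth of `K_θ` -/

/-- `conj Θ_θ(u + ib) = Θ_θ(−u + ib)` (Schwarz reflection `ξ(s̄) = conj ξ(s)`, `ξ` being real on the real axis,
and `conj(½ + b − iu) = ½ + b + iu`). [cite: Titchmarsh1986, §2.1] -/
theorem conj_limTheta_line (θ u b : ℝ) :
    conj (limTheta θ ((u : ℂ) + (b : ℂ) * I)) = limTheta θ (((-u : ℝ) : ℂ) + (b : ℂ) * I) := by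
  have hs : conj ((1 : ℂ) / 2 - I * ((u : ℂ) + (b : ℂ) * I)) = (1 : ℂ) / 2 - I * (((-u : ℝ) : ℂ) + (b : ℂ) * I) := by
    rw [half_sub_I_mul_line_eq, half_sub_I_mul_line_eq]
    simp only [map_add, map_mul, Complex.conj_ofReal, Complex.conj_I, neg_neg]
    push_cast
    ring
  unfold limTheta
  rw [← Complex.exp_conj]
  congr 1
  simp only [map_mul, map_neg, map_div₀, map_ofNat, Complex.conj_ofReal]
  rw [← riemannXi_conj_holds, ← deriv_riemannXi_conj, hs]

/-- The line integrand at `−u` is the conjugate of the line integrand at `u`. [folklore] -/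
private theorem conj_limTheta_lineIntegrand (θ b x u : ℝ) :
    conj (limTheta θ ((u : ℂ) + (b : ℂ) * I) * Complex.exp (-I * ((u : ℂ) + (b : ℂ) * I) * (x : ℂ))) =
      limTheta θ (((-u : ℝ) : ℂ) + (b : ℂ) * I) *
        Complex.exp (-I * (((-u : ℝ) : ℂ) + (b : ℂ) * I) * (x : ℂ)) := by
  rw [map_mul, conj_limTheta_line, ← Complex.exp_conj]
  congr 2
  simp only [map_mul, map_neg, Complex.conj_I, map_add, Complex.conj_ofReal, neg_neg]
  push_cast
  ring

/-- **Reality** (RH-free): `invFourierLine Θ_θ b x` is real. [cite: Suzuki2020IntegralOperators, Thm. 1.2 (K-ii)] -/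
theorem conj_invFourierLine_limTheta (θ b x : ℝ) :
    conj (invFourierLine (limTheta θ) b x) = invFourierLine (limTheta θ) b x := by
  unfold invFourierLine
  rw [map_mul]
  congr 1
  · rw [map_div₀, map_one, map_mul, Complex.conj_ofReal, map_ofNat]
  · rw [← integral_conj]
    simp_rw [conj_limTheta_lineIntegrand]
    have h := (integral_neg_eq_self (μ := (volume : Measure ℝ))
      (fun u : ℝ => limTheta θ ((u : ℂ) + (b : ℂ) * I) * Complex.exp (-I * ((u : ℂ) + (b : ℂ) * I) * (x : ℂ))))
    simpa using h

/-- `Im (invFourierLine Θ_θ b x) = 0`. [cite: Suzuki2020IntegralOperators, Thm. 1.2 (K-ii)] -/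
theorem im_invFourierLine_limTheta (θ b x : ℝ) : (invFourierLine (limTheta θ) b x).im = 0 := by
  have h := conj_invFourierLine_limTheta θ b x
  have := congrArg Complex.im h
  simp only [Complex.conj_im] at this
  linarith

/-- `K_θ` as a complex number is the full line integral: `(K_θ(x) : ℂ) = invFourierLine Θ_θ 1 x`.
[cite: Suzuki2020IntegralOperators, Thm. 1.2 (K-ii)] -/
theorem ofReal_limKernel (θ x : ℝ) : (limKernel θ x : ℂ) = invFourierLine (limTheta θ) 1 x := by
  apply Complex.ext
  · simp [limKernel]
  · simp [limKernel, im_invFourierLine_limTheta]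

/-- Dominated convergence on a horizontal line: if the inverse-Fourier integrand on `Im z = c ≥ 0` is
integrable for every real `x`, then `x ↦ invFourierLine Φ c x` is continuous (local domination by
`‖Φ(u+ic)‖ e^{c(x₀+1)}`) — the continuity clause of (K-ii) in generic form. [cite: Suzuki2020IntegralOperators, Thm. 1.2 (K-ii)] -/
theorem continuous_invFourierLine {Φ : ℂ → ℂ} {c : ℝ} (hc : 0 ≤ c)
    (hInt : ∀ x : ℝ, Integrable (fun u : ℝ => Φ ((u : ℂ) + (c : ℂ) * I) *
      Complex.exp (-I * ((u : ℂ) + (c : ℂ) * I) * (x : ℂ)))) :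
    Continuous (fun x : ℝ => invFourierLine Φ c x) := by
  have hcont : Continuous (fun x : ℝ => ∫ u : ℝ, Φ ((u : ℂ) + (c : ℂ) * I) *
      Complex.exp (-I * ((u : ℂ) + (c : ℂ) * I) * (x : ℂ))) := by
    refine continuous_iff_continuousAt.2 fun x₀ => ?_
    refine continuousAt_of_dominated
      (bound := fun u => ‖Φ ((u : ℂ) + (c : ℂ) * I)‖ * Real.exp (c * (x₀ + 1))) ?_ ?_ ?_ ?_
    · exact Eventually.of_forall fun x => (hInt x).aestronglyMeasurable
    · have hnhds : Set.Iio (x₀ + 1) ∈ nhds x₀ := Iio_mem_nhds (by linarith)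
      filter_upwards [hnhds] with x hx
      refine Eventually.of_forall fun u => ?_
      rw [norm_mul, norm_cexp_neg_I_line]
      exact mul_le_mul_of_nonneg_left
        (Real.exp_le_exp.2 (mul_le_mul_of_nonneg_left (le_of_lt (Set.mem_Iio.mp hx)) hc)) (norm_nonneg _)
    · have h0 : Integrable (fun u : ℝ => ‖Φ ((u : ℂ) + (c : ℂ) * I)‖) := by
        have h := (hInt 0).norm
        simpa [norm_cexp_neg_I_line] using h
      exact h0.mul_const _
    · refine Eventually.of_forall fun u => ?_
      have h : Continuous fun x : ℝ => Φ ((u : ℂ) + (c : ℂ) * I) *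
          Complex.exp (-I * ((u : ℂ) + (c : ℂ) * I) * (x : ℂ)) :=
        continuous_const.mul (Complex.continuous_exp.comp (continuous_const.mul Complex.continuous_ofReal))
      exact h.continuousAt
  unfold invFourierLine
  exact continuous_const.mul hcont

/-- **[Su20] Thm. 1.2 (K-ii), first clause, PROVED** (RH-free): `K_θ` is continuous for `θ > 1`.
[cite: Suzuki2020IntegralOperators, Thm. 1.2 (K-ii)] -/
theorem Suzuki2020_thm12_continuous {θ : ℝ} (hθ : 1 < θ) : Continuous (limKernel θ) := by
  have h : Continuous fun x : ℝ => invFourierLine (limTheta θ) 1 x :=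
    continuous_invFourierLine zero_le_one (fun x => by
      simpa using integrable_limTheta_lineIntegrand hθ (b := 1) (by norm_num) x)
  exact Complex.continuous_re.comp h

/-- **Growth of `K_θ`** (RH-free): for `θ > 1` and every `b > ½` there is `D ≥ 0` with `|K_θ(x)| ≤ D e^{bx}`
for all real `x` (printed: `K_θ(x) ≪ e^{x/2}`; here `≪_b e^{bx}` for each `b > ½`).
[cite: Suzuki2020IntegralOperators, Thm. 1.2 (K-ii)] -/
theorem abs_limKernel_le {θ : ℝ} (hθ : 1 < θ) {b : ℝ} (hb : 1 / 2 < b) :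
    ∃ D : ℝ, 0 ≤ D ∧ ∀ x : ℝ, |limKernel θ x| ≤ D * Real.exp (b * x) := by
  obtain ⟨D, hD0, hD⟩ := norm_invFourierLine_limTheta_le hθ hb
  refine ⟨D, hD0, fun x => ?_⟩
  calc |limKernel θ x| = |(invFourierLine (limTheta θ) 1 x).re| := rfl
    _ ≤ ‖invFourierLine (limTheta θ) 1 x‖ := Complex.abs_re_le_norm _
    _ = ‖invFourierLine (limTheta θ) b x‖ := by rw [invFourierLine_limTheta_eq hθ (by norm_num) hb]
    _ ≤ D * Real.exp (b * x) := hD b le_rfl x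

/-! ## §6 The Fourier formula of (K-ii): `∫ K_θ(x) e^{izx} dx = Θ_θ(z)` for `Im z > ½` -/

/-- Mathlib's inverse Fourier transform on `ℝ` as an explicit exponential integral. [folklore] -/
private theorem fourierInv_real_eq_integral_exp_smul' (f : ℝ → ℂ) (w : ℝ) :
    𝓕⁻ f w = ∫ v : ℝ, Complex.exp (↑(2 * π * v * w) * I) • f v := by
  rw [Real.fourierInv_eq_fourier_neg, Real.fourier_real_eq_integral_exp_smul]
  congr 1 with v
  congr 2
  push_cast
  ring

/-- `‖e^{izx}‖ = e^{−(Im z) x}` for real `x`. [folklore] -/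
private theorem norm_cexp_I_mul_mul_ofReal (z : ℂ) (x : ℝ) :
    ‖Complex.exp (I * z * (x : ℂ))‖ = Real.exp (-(z.im * x)) := by
  rw [Complex.norm_exp]
  congr 1
  simp only [Complex.mul_re, Complex.mul_im, Complex.I_re, Complex.I_im, Complex.ofReal_re,
    Complex.ofReal_im]
  ring

/-- The line transform in terms of Mathlib's Fourier transform of `φ_b = Θ_θ(· + ib)`:
`invFourierLine Θ_θ b x = (2π)⁻¹ e^{bx} · 𝓕 φ_b (x/2π)`. [folklore] -/
private theorem invFourierLine_eq_fourier (Φ : ℂ → ℂ) (b x : ℝ) :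
    invFourierLine Φ b x = (1 : ℂ) / (2 * (Real.pi : ℂ)) *
      (Complex.exp ((b * x : ℝ) : ℂ) * 𝓕 (fun u : ℝ => Φ ((u : ℂ) + (b : ℂ) * I)) (x / (2 * π))) := by
  unfold invFourierLine
  congr 1
  rw [Real.fourier_real_eq_integral_exp_smul, ← integral_const_mul]
  congr 1
  funext u
  have hreal : -2 * π * u * (x / (2 * π)) = -(u * x) := by
    field_simp
  rw [smul_eq_mul, hreal]
  have hexp : -I * ((u : ℂ) + (b : ℂ) * I) * (x : ℂ) = ((b * x : ℝ) : ℂ) + ((-(u * x) : ℝ) : ℂ) * I := by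
    push_cast
    linear_combination (-(b : ℂ) * (x : ℂ)) * I_mul_I
  rw [hexp, Complex.exp_add]
  ring

/-- **[Su20] Thm. 1.2 (K-ii), Fourier formula, PROVED** (RH-free): for `θ > 1` and `Im z > ½`,
`x ↦ K_θ(x) e^{izx}` is integrable on `ℝ` and `∫ K_θ(x) e^{izx} dx = Θ_θ(z)` — i.e. (1.9),
`exp(−2θ ξ'/ξ(s)) = ∫ K_θ(x) e^{izx} dx`, `s = ½ − iz`, for the spectrally defined kernel.
Proof: with `b = Im z`, `K_θ(x)e^{−bx} = (2π)⁻¹ 𝓕φ_b(x/2π)` (line independence §3 + reality §5) is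
integrable (`= 0` on `x < 0` by §4, `O(e^{−(b−b')x})` on `x > 0` by the growth bound from a line
`½ < b' < b`), so Mathlib's `Continuous.fourierInv_fourier_eq` applies to the continuous integrable `φ_b`.
[cite: Suzuki2020IntegralOperators, Thm. 1.2 (K-ii), eq. (1.9)] -/
theorem Suzuki2020_thm12_fourier {θ : ℝ} (hθ : 1 < θ) {z : ℂ} (hz : 1 / 2 < z.im) :
    Integrable (fun x : ℝ => (limKernel θ x : ℂ) * Complex.exp (I * z * x)) ∧
      ∫ x : ℝ, (limKernel θ x : ℂ) * Complex.exp (I * z * x) = limTheta θ z := by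
  set a : ℝ := z.re with ha
  set b : ℝ := z.im with hb
  have hzab : (a : ℂ) + (b : ℂ) * I = z := Complex.re_add_im z
  have hb0 : 0 ≤ b := by linarith
  -- the symbol on the line `Im = b`
  set φ : ℝ → ℂ := fun u => limTheta θ ((u : ℂ) + (b : ℂ) * I) with hφ
  have hφc : Continuous φ := continuous_limTheta_line θ hz.le
  have hφi : Integrable φ := integrable_limTheta_line hθ hz
  -- the kernel as a complex-valued function, on the line `b`
  set Kc : ℝ → ℂ := fun x => invFourierLine (limTheta θ) b x with hKc
  have hKc_eq : ∀ x : ℝ, (limKernel θ x : ℂ) = Kc x := fun x => by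
    rw [ofReal_limKernel, invFourierLine_limTheta_eq hθ (by norm_num) hz]
  have hdagger : ∀ x : ℝ, Kc x = (1 : ℂ) / (2 * (Real.pi : ℂ)) *
      (Complex.exp ((b * x : ℝ) : ℂ) * 𝓕 φ (x / (2 * π))) := fun x => invFourierLine_eq_fourier _ b x
  have hK0 : ∀ x : ℝ, x < 0 → Kc x = 0 := fun x hx => invFourierLine_limTheta_eq_zero_of_neg hθ hz hx
  -- growth from an intermediate line `½ < b' < b`
  set b' : ℝ := (1 / 2 + b) / 2 with hb'
  have hb'₁ : 1 / 2 < b' := by rw [hb']; linarith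
  have hb'₂ : b' < b := by rw [hb']; linarith
  obtain ⟨D, hD0, hD⟩ := norm_invFourierLine_limTheta_le hθ hb'₁
  have hKc_bound : ∀ x : ℝ, ‖Kc x‖ ≤ D * Real.exp (b' * x) := fun x => by
    rw [show Kc x = invFourierLine (limTheta θ) b' x from invFourierLine_limTheta_eq hθ hz hb'₁ x]
    exact hD b' le_rfl x
  have hKc_cont : Continuous Kc :=
    continuous_invFourierLine hb0 (integrable_limTheta_lineIntegrand hθ hz)
  -- the target integrand
  set G : ℝ → ℂ := fun x => Kc x * Complex.exp (I * z * x) with hG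
  have hG_cont : Continuous G := hKc_cont.mul (by fun_prop)
  have hG_norm : ∀ x : ℝ, ‖G x‖ = ‖Kc x‖ * Real.exp (-(b * x)) := fun x => by
    rw [hG]; simp only [norm_mul, norm_cexp_I_mul_mul_ofReal, hb]
  have hG_int : Integrable G := by
    have hmaj : Integrable (Set.indicator (Ici (0 : ℝ)) fun x : ℝ => D * Real.exp (-(b - b') * x)) := by
      refine IntegrableOn.integrable_indicator ?_ measurableSet_Ici
      rw [integrableOn_Ici_iff_integrableOn_Ioi]
      exact (exp_neg_integrableOn_Ioi 0 (by linarith : 0 < b - b')).const_mul D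
    refine hmaj.mono' hG_cont.aestronglyMeasurable (Eventually.of_forall fun x => ?_)
    rcases lt_or_ge x 0 with hx | hx
    · have : G x = 0 := by rw [hG]; simp [hK0 x hx]
      rw [this, norm_zero, Set.indicator_of_notMem (by simpa using hx)]
    · rw [Set.indicator_of_mem (by simpa using hx), hG_norm]
      calc ‖Kc x‖ * Real.exp (-(b * x)) ≤ D * Real.exp (b' * x) * Real.exp (-(b * x)) :=
            mul_le_mul_of_nonneg_right (hKc_bound x) (Real.exp_pos _).le
        _ = D * Real.exp (-(b - b') * x) := by rw [mul_assoc, ← Real.exp_add]; ring_nf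
  -- `𝓕 φ` in terms of `G`
  have hπC : (Real.pi : ℂ) ≠ 0 := by exact_mod_cast Real.pi_ne_zero
  have hF_eq : ∀ w : ℝ, 𝓕 φ w = (2 * (Real.pi : ℂ)) * Complex.exp (↑(-2 * π * a * w) * I) * G (2 * π * w) := by
    intro w
    have h1 := hdagger (2 * π * w)
    have hw : 2 * π * w / (2 * π) = w := by field_simp
    rw [hw] at h1
    -- solve `h1 : Kc x = (1/2π) (e^{bx} 𝓕φ w)` for `𝓕 φ w`
    have h2 : 𝓕 φ w = (2 * (Real.pi : ℂ)) * Complex.exp (-(((b * (2 * π * w) : ℝ)) : ℂ)) * Kc (2 * π * w) := by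
      rw [h1, Complex.exp_neg]
      field_simp
    have key : Complex.exp (-(((b * (2 * π * w) : ℝ)) : ℂ)) =
        Complex.exp (↑(-2 * π * a * w) * I) * Complex.exp (I * z * ↑(2 * π * w)) := by
      rw [← Complex.exp_add]
      congr 1
      rw [← hzab]
      push_cast
      linear_combination (-(2 : ℂ) * (π : ℂ) * (b : ℂ) * (w : ℂ)) * I_mul_I
    rw [h2, hG, key]
    simp only
    ring
  have hF_int : Integrable (𝓕 φ) := by
    have hGs : Integrable fun w : ℝ => G (2 * π * w) := hG_int.comp_mul_left' (by positivity)
    have h := hGs.bdd_mul (f := fun w : ℝ => (2 * (Real.pi : ℂ)) * Complex.exp (↑(-2 * π * a * w) * I))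
      (c := 2 * π) (by fun_prop) (Eventually.of_forall fun w => by
        rw [norm_mul, Complex.norm_exp_ofReal_mul_I, mul_one]
        simp [abs_of_pos Real.pi_pos])
    exact h.congr (Eventually.of_forall fun w => (hF_eq w).symm)
  -- Fourier inversion at the point `a`
  have hinv := congrFun (hφc.fourierInv_fourier_eq hφi hF_int) a
  rw [fourierInv_real_eq_integral_exp_smul'] at hinv
  have hint_eq : ∫ v : ℝ, Complex.exp (↑(2 * π * v * a) * I) • 𝓕 φ v =
      ∫ v : ℝ, (2 * (Real.pi : ℂ)) * G (2 * π * v) := by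
    congr 1; funext v
    rw [smul_eq_mul, hF_eq v]
    have key2 : Complex.exp (↑(2 * π * v * a) * I) * Complex.exp (↑(-2 * π * a * v) * I) = 1 := by
      rw [← Complex.exp_add, ← Complex.exp_zero]
      congr 1
      push_cast
      ring
    calc Complex.exp (↑(2 * π * v * a) * I) * ((2 * (Real.pi : ℂ)) * Complex.exp (↑(-2 * π * a * v) * I) *
          G (2 * π * v))
        = (2 * (Real.pi : ℂ)) * (Complex.exp (↑(2 * π * v * a) * I) * Complex.exp (↑(-2 * π * a * v) * I)) *
          G (2 * π * v) := by ring
      _ = (2 * (Real.pi : ℂ)) * G (2 * π * v) := by rw [key2, mul_one]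
  rw [hint_eq, integral_const_mul, MeasureTheory.Measure.integral_comp_mul_left (fun x => G x)] at hinv
  have hπabs : |(2 * π)⁻¹| = (2 * π)⁻¹ := abs_of_pos (by positivity)
  rw [hπabs] at hinv
  have hGint : ∫ x : ℝ, G x = limTheta θ z := by
    rw [← hzab]
    change _ = φ a
    rw [← hinv, Complex.real_smul]
    push_cast
    field_simp
  refine ⟨hG_int.congr (Eventually.of_forall fun x => by rw [hG]; simp only [hKc_eq x]), ?_⟩
  rw [← hGint, hG]
  congr 1; funext x; rw [hKc_eq x]

/-- The `(0, ∞)` form of the Fourier formula (the shape used by the DBR column's `KernelLaplaceIdentity`):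
for `θ > 1`, `Im z > ½`, `x ↦ K_θ(x)e^{izx}` is integrable on `(0,∞)` and `∫₀^∞ K_θ(x) e^{izx} dx = Θ_θ(z)`
(by (K-iii) the integrand vanishes on `(−∞,0)`). [cite: Suzuki2020IntegralOperators, Thm. 1.2 (K-ii)–(K-iii), eq. (1.9)] -/
theorem Suzuki2020_thm12_laplace {θ : ℝ} (hθ : 1 < θ) {z : ℂ} (hz : 1 / 2 < z.im) :
    IntegrableOn (fun x : ℝ => (limKernel θ x : ℂ) * Complex.exp (I * z * x)) (Ioi 0) ∧
      ∫ x in Ioi (0 : ℝ), (limKernel θ x : ℂ) * Complex.exp (I * z * x) = limTheta θ z := by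
  obtain ⟨hint, heq⟩ := Suzuki2020_thm12_fourier hθ hz
  refine ⟨hint.integrableOn, ?_⟩
  rw [setIntegral_congr_set Ioi_ae_eq_Ici, setIntegral_eq_integral_of_forall_compl_eq_zero, heq]
  intro x hx
  have hx' : x < 0 := by simpa using hx
  simp [Suzuki2020_thm12_Kiii hθ hx']

/-- **Summary of what is proved of [Su20] Thm. 1.2 here** (RH-free), in the shape of the clauses of the
named fact `Suzuki2020_thm12`: for `θ > 1`, (K-ii) continuity and the Fourier formula (with integrability)
for `Im z > ½`, and (K-iii). [cite: Suzuki2020IntegralOperators, Thm. 1.2] -/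
theorem Suzuki2020_thm12_Kii_Kiii {θ : ℝ} (hθ : 1 < θ) :
    Continuous (limKernel θ) ∧
    (∀ z : ℂ, 1 / 2 < z.im →
      Integrable (fun x : ℝ => (limKernel θ x : ℂ) * Complex.exp (I * z * x)) ∧
      ∫ x : ℝ, (limKernel θ x : ℂ) * Complex.exp (I * z * x) = limTheta θ z) ∧
    (∀ x : ℝ, x < 0 → limKernel θ x = 0) :=
  ⟨Suzuki2020_thm12_continuous hθ, fun _ hz => Suzuki2020_thm12_fourier hθ hz,
    fun _ hx => Suzuki2020_thm12_Kiii hθ hx⟩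

end Literature.NumberTheory.LFunctions

end
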